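import Mathlib
import Summits.Ventures.PercRepro2.TypedSepThreeClosure
import Summits.Ventures.PercRepro2.TypedSepThreeStates

/-!
# The typed (SEP-3) zero, III′: the split and the states of the support (blind cell PercRepro2,
p3 g6, 2026-08-25; `proofs/P3-BRIDGE.md` §11.20)

For the (SEP-3) split (`Split`: the doors `a₁, a₃` separate the o-side `WO ∋ o` from the b-side
`WB ∋ a₂, b`) the two-door closure lemmas of `TypedSepThreeClosure.lean` give the seven
coordinates of the state of a copy, and the state is the gluing of the two side states
(`st_eq_sepSt`).  Own work; standard axioms.
-/

namespace Summit.Ventures.PercRepro2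

open UnionCluster

namespace CovForm

namespace SepThree

open OneTyped TypedA3 Untouched TypedFactor Separated RootBridge

/-! ## The (SEP-3) split and the states of the support -/

section Support

open Classical

variable {V : Type*} {E : Type*} [Fintype E] [DecidableEq E]
variable (ends : E → Sym2 V) (o a₁ a₂ a₃ b : V)

/-- **The two-door split of the support**: the doors `a₁, a₃` separate the o-side `WO ∋ o` from
the b-side `WB ∋ a₂, b` in the support `z ∪ F` — every open edge within one side, the sides
meeting only in the doors, no typed edge within both. -/
structure Split (WO WB : Set V) (F : Finset E) (z : Config E) : Prop where
  split : ∀ e, zF F z e = true → e ∈ within ends WO ∨ e ∈ within ends WB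
  cap : ∀ t, t ∈ WO → t ∈ WB → t = a₁ ∨ t = a₃
  noloop : ∀ e ∈ F, ¬ (e ∈ within ends WO ∧ e ∈ within ends WB)
  oO : o ∈ WO
  a1O : a₁ ∈ WO
  a1B : a₁ ∈ WB
  a3O : a₃ ∈ WO
  a3B : a₃ ∈ WB
  a2B : a₂ ∈ WB
  bB : b ∈ WB
  o1 : o ≠ a₁
  o3 : o ≠ a₃
  a21 : a₂ ≠ a₁
  a23 : a₂ ≠ a₃
  b1 : b ≠ a₁
  b3 : b ≠ a₃

/-- The o-side state `(α, β, X)` of a configuration: `a₁ ~ o`, `a₃ ~ o`, `a₁ ~ a₃` inside `WO`. -/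
noncomputable def oSt (WO : Set V) (x : Config E) : OSt :=
  (decide (Conn ends (withinRestr ends WO x) a₁ o), decide (Conn ends (withinRestr ends WO x) a₃ o),
    decide (Conn ends (withinRestr ends WO x) a₁ a₃))

/-- The b-side state `(h₁₂, h₃₂, Y, b₁, b₂, b₃)` of a configuration: `a₂ ~ a₁`, `a₂ ~ a₃`,
`a₁ ~ a₃`, `a₁ ~ b`, `a₂ ~ b`, `a₃ ~ b` inside `WB`. -/
noncomputable def bSt (WB : Set V) (x : Config E) : BSt :=
  (decide (Conn ends (withinRestr ends WB x) a₂ a₁),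
    decide (Conn ends (withinRestr ends WB x) a₂ a₃),
    decide (Conn ends (withinRestr ends WB x) a₁ a₃),
    decide (Conn ends (withinRestr ends WB x) a₁ b),
    decide (Conn ends (withinRestr ends WB x) a₂ b),
    decide (Conn ends (withinRestr ends WB x) a₃ b))

variable {ends o a₁ a₂ a₃ b}

/-- Validity of an o-side state, in `Prop` form. -/
lemma validO_iff (s : OSt) : ValidO s = true ↔
    ((s.1 = true ∧ s.2.1 = true → s.2.2 = true) ∧ (s.1 = true ∧ s.2.2 = true → s.2.1 = true) ∧
      (s.2.1 = true ∧ s.2.2 = true → s.1 = true)) := by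
  revert s; decide

/-- Validity of a b-side state, in `Prop` form. -/
lemma validB_iff (t : BSt) : ValidB t = true ↔
    ((t.1 = true ∧ t.2.1 = true → t.2.2.1 = true) ∧ (t.1 = true ∧ t.2.2.1 = true → t.2.1 = true) ∧
        (t.2.1 = true ∧ t.2.2.1 = true → t.1 = true)) ∧
      ((t.1 = true ∧ t.2.2.2.1 = true → t.2.2.2.2.1 = true) ∧
        (t.1 = true ∧ t.2.2.2.2.1 = true → t.2.2.2.1 = true) ∧
        (t.2.2.2.1 = true ∧ t.2.2.2.2.1 = true → t.1 = true)) ∧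
      ((t.2.2.1 = true ∧ t.2.2.2.1 = true → t.2.2.2.2.2 = true) ∧
        (t.2.2.1 = true ∧ t.2.2.2.2.2 = true → t.2.2.2.1 = true) ∧
        (t.2.2.2.1 = true ∧ t.2.2.2.2.2 = true → t.2.2.1 = true)) ∧
      ((t.2.1 = true ∧ t.2.2.2.2.1 = true → t.2.2.2.2.2 = true) ∧
        (t.2.1 = true ∧ t.2.2.2.2.2 = true → t.2.2.2.2.1 = true) ∧
        (t.2.2.2.2.1 = true ∧ t.2.2.2.2.2 = true → t.2.1 = true)) := by
  revert t; decide

omit [Fintype E] [DecidableEq E] in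
/-- The o-side state of any configuration is valid (transitivity inside `WO`). -/
lemma validO_oSt (WO : Set V) (x : Config E) : ValidO (oSt ends o a₁ a₃ WO x) = true := by
  rw [validO_iff]
  simp only [oSt, decide_eq_true_eq]
  exact ⟨fun h => conn_trans h.1 (conn_symm h.2), fun h => conn_trans (conn_symm h.2) h.1,
    fun h => conn_trans h.2 h.1⟩

omit [Fintype E] [DecidableEq E] in
/-- The b-side state of any configuration is valid (transitivity inside `WB`). -/
lemma validB_bSt (WB : Set V) (x : Config E) : ValidB (bSt ends a₁ a₂ a₃ b WB x) = true := by
  rw [validB_iff]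
  simp only [bSt, decide_eq_true_eq]
  exact ⟨⟨fun h => conn_trans (conn_symm h.1) h.2, fun h => conn_trans h.1 h.2,
      fun h => conn_trans h.1 (conn_symm h.2)⟩,
    ⟨fun h => conn_trans h.1 h.2, fun h => conn_trans (conn_symm h.1) h.2,
      fun h => conn_trans h.2 (conn_symm h.1)⟩,
    ⟨fun h => conn_trans (conn_symm h.1) h.2, fun h => conn_trans h.1 h.2,
      fun h => conn_trans h.1 (conn_symm h.2)⟩,
    ⟨fun h => conn_trans (conn_symm h.1) h.2, fun h => conn_trans h.1 h.2,
      fun h => conn_trans h.1 (conn_symm h.2)⟩⟩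

variable {WO WB : Set V} {F : Finset E} {z : Config E}

omit [Fintype E] in
/-- A configuration below `z ∪ F` has its open edges within a side. -/
lemma split_of_le (h : Split ends o a₁ a₂ a₃ b WO WB F z) {x : Config E} (hx : x ≤ zF F z) :
    ∀ e, x e = true → e ∈ within ends WO ∨ e ∈ within ends WB := fun e he =>
  h.split e (by have := hx e; rw [he] at this; exact Bool.eq_true_of_true_le this)

/-! ### The seven coordinates -/

section Coords

variable (h : Split ends o a₁ a₂ a₃ b WO WB F z) {x : Config E}
  (hsp : ∀ e, x e = true → e ∈ within ends WO ∨ e ∈ within ends WB)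

omit [Fintype E] in
include h hsp in
/-- `a₁ ~ a₃`. -/
lemma conn_a1a3 : Conn ends x a₁ a₃ ↔
    Conn ends (withinRestr ends WO x) a₁ a₃ ∨ Conn ends (withinRestr ends WB x) a₁ a₃ :=
  conn_doors ends hsp h.cap h.a1O h.a1B

omit [Fintype E] [DecidableEq E] in
include hsp in
/-- The b-side split with the roles of the sides exchanged. -/
lemma hsp' : ∀ e, x e = true → e ∈ within ends WB ∨ e ∈ within ends WO := fun e he =>
  (hsp e he).symm

omit [Fintype E] in
include h in
/-- The doors from the b-side. -/
lemma cap' : ∀ t, t ∈ WB → t ∈ WO → t = a₁ ∨ t = a₃ := fun t h1 h2 => h.cap t h2 h1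

omit [Fintype E] in
include h hsp in
/-- `a₂ ~ a₁ = h₁₂ ∨ (X ∧ h₃₂)`. -/
lemma conn_a2a1 : Conn ends x a₂ a₁ ↔
    Conn ends (withinRestr ends WB x) a₂ a₁ ∨
      (Conn ends (withinRestr ends WO x) a₁ a₃ ∧ Conn ends (withinRestr ends WB x) a₂ a₃) := by
  have hin := conn_inside ends (hsp' hsp) (cap' h) h.a1B h.a1O h.a3B h.a3O h.a2B h.a1B
  rw [conn_a1a3 h hsp] at hin
  constructor
  · intro hc
    rcases hin.1 hc with hc | ⟨hX | hY, ⟨h12, _⟩ | ⟨h32, _⟩⟩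
    · exact Or.inl hc
    · exact Or.inl h12
    · exact Or.inr ⟨hX, h32⟩
    · exact Or.inl h12
    · exact Or.inl (conn_trans h32 (conn_symm hY))
  · rintro (hc | ⟨hX, h32⟩)
    · exact conn_mono (withinRestr_le ends WB x) hc
    · exact conn_trans (conn_mono (withinRestr_le ends WB x) h32)
        (conn_mono (withinRestr_le ends WO x) (conn_symm hX))

omit [Fintype E] in
include h hsp in
/-- `a₂ ~ a₃ = h₃₂ ∨ (X ∧ h₁₂)`. -/
lemma conn_a2a3 : Conn ends x a₂ a₃ ↔
    Conn ends (withinRestr ends WB x) a₂ a₃ ∨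
      (Conn ends (withinRestr ends WO x) a₁ a₃ ∧ Conn ends (withinRestr ends WB x) a₂ a₁) := by
  have hin := conn_inside ends (hsp' hsp) (cap' h) h.a1B h.a1O h.a3B h.a3O h.a2B h.a3B
  rw [conn_a1a3 h hsp] at hin
  constructor
  · intro hc
    rcases hin.1 hc with hc | ⟨hX | hY, ⟨h12, _⟩ | ⟨h32, _⟩⟩
    · exact Or.inl hc
    · exact Or.inr ⟨hX, h12⟩
    · exact Or.inl h32
    · exact Or.inl (conn_trans h12 hY)
    · exact Or.inl h32
  · rintro (hc | ⟨hX, h12⟩)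
    · exact conn_mono (withinRestr_le ends WB x) hc
    · exact conn_trans (conn_mono (withinRestr_le ends WB x) h12)
        (conn_mono (withinRestr_le ends WO x) hX)

omit [Fintype E] in
include h hsp in
/-- `a₁ ~ o = α ∨ (β ∧ (X ∨ Y))`. -/
lemma conn_a1o : Conn ends x a₁ o ↔
    Conn ends (withinRestr ends WO x) a₁ o ∨
      (Conn ends (withinRestr ends WO x) a₃ o ∧
        (Conn ends (withinRestr ends WO x) a₁ a₃ ∨ Conn ends (withinRestr ends WB x) a₁ a₃)) := by
  have hin := conn_inside ends hsp h.cap h.a1O h.a1B h.a3O h.a3B h.a1O h.oO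
  rw [conn_a1a3 h hsp] at hin
  constructor
  · intro hc
    rcases hin.1 hc with hc | ⟨hXY, ⟨_, h3o⟩ | ⟨_, h1o⟩⟩
    · exact Or.inl hc
    · exact Or.inr ⟨h3o, hXY⟩
    · exact Or.inl h1o
  · rintro (hc | ⟨h3o, hXY⟩)
    · exact conn_mono (withinRestr_le ends WO x) hc
    · exact conn_trans ((conn_a1a3 h hsp).2 hXY) (conn_mono (withinRestr_le ends WO x) h3o)

omit [Fintype E] in
include h hsp in
/-- `a₃ ~ o = β ∨ (α ∧ (X ∨ Y))`. -/
lemma conn_a3o : Conn ends x a₃ o ↔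
    Conn ends (withinRestr ends WO x) a₃ o ∨
      (Conn ends (withinRestr ends WO x) a₁ o ∧
        (Conn ends (withinRestr ends WO x) a₁ a₃ ∨ Conn ends (withinRestr ends WB x) a₁ a₃)) := by
  have hin := conn_inside ends hsp h.cap h.a1O h.a1B h.a3O h.a3B h.a3O h.oO
  rw [conn_a1a3 h hsp] at hin
  constructor
  · intro hc
    rcases hin.1 hc with hc | ⟨hXY, ⟨_, h3o⟩ | ⟨_, h1o⟩⟩
    · exact Or.inl hc
    · exact Or.inl h3o
    · exact Or.inr ⟨h1o, hXY⟩
  · rintro (hc | ⟨h1o, hXY⟩)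
    · exact conn_mono (withinRestr_le ends WO x) hc
    · exact conn_trans (conn_symm ((conn_a1a3 h hsp).2 hXY))
        (conn_mono (withinRestr_le ends WO x) h1o)

omit [Fintype E] in
include h hsp in
/-- `a₂ ~ o = (α ∧ (a₂ ~ a₁)) ∨ (β ∧ (a₂ ~ a₃))`. -/
lemma conn_a2o : Conn ends x a₂ o ↔
    (Conn ends (withinRestr ends WO x) a₁ o ∧
        (Conn ends (withinRestr ends WB x) a₂ a₁ ∨
          (Conn ends (withinRestr ends WO x) a₁ a₃ ∧
            Conn ends (withinRestr ends WB x) a₂ a₃))) ∨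
      (Conn ends (withinRestr ends WO x) a₃ o ∧
        (Conn ends (withinRestr ends WB x) a₂ a₃ ∨
          (Conn ends (withinRestr ends WO x) a₁ a₃ ∧
            Conn ends (withinRestr ends WB x) a₂ a₁))) := by
  have hoB : o ∉ WB := fun hoB => by
    rcases h.cap o h.oO hoB with h1 | h3
    · exact h.o1 h1
    · exact h.o3 h3
  rw [← conn_a2a1 h hsp, ← conn_a2a3 h hsp]
  constructor
  · intro hc
    rcases conn_door ends (hsp' hsp) (cap' h) h.a2B hoB hc with ⟨h21, h1o⟩ | ⟨h23, h3o⟩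
    · rcases (conn_a1o h hsp).1 h1o with hα | ⟨hβ, hXY⟩
      · exact Or.inl ⟨hα, h21⟩
      · exact Or.inr ⟨hβ, conn_trans h21 ((conn_a1a3 h hsp).2 hXY)⟩
    · rcases (conn_a3o h hsp).1 h3o with hβ | ⟨hα, hXY⟩
      · exact Or.inr ⟨hβ, h23⟩
      · exact Or.inl ⟨hα, conn_trans h23 (conn_symm ((conn_a1a3 h hsp).2 hXY))⟩
  · rintro (⟨hα, h21⟩ | ⟨hβ, h23⟩)
    · exact conn_trans h21 (conn_mono (withinRestr_le ends WO x) hα)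
    · exact conn_trans h23 (conn_mono (withinRestr_le ends WO x) hβ)

omit [Fintype E] in
include h hsp in
/-- `a₁ ~ b = b₁ ∨ (b₃ ∧ (X ∨ Y))`. -/
lemma conn_a1b : Conn ends x a₁ b ↔
    Conn ends (withinRestr ends WB x) a₁ b ∨
      (Conn ends (withinRestr ends WB x) a₃ b ∧
        (Conn ends (withinRestr ends WO x) a₁ a₃ ∨ Conn ends (withinRestr ends WB x) a₁ a₃)) := by
  have hin := conn_inside ends (hsp' hsp) (cap' h) h.a1B h.a1O h.a3B h.a3O h.a1B h.bB
  rw [conn_a1a3 h hsp] at hin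
  constructor
  · intro hc
    rcases hin.1 hc with hc | ⟨hXY, ⟨_, h3b⟩ | ⟨_, h1b⟩⟩
    · exact Or.inl hc
    · exact Or.inr ⟨h3b, hXY⟩
    · exact Or.inl h1b
  · rintro (hc | ⟨h3b, hXY⟩)
    · exact conn_mono (withinRestr_le ends WB x) hc
    · exact conn_trans ((conn_a1a3 h hsp).2 hXY) (conn_mono (withinRestr_le ends WB x) h3b)

omit [Fintype E] in
include h hsp in
/-- `a₂ ~ b = b₂ ∨ (b₁ ∧ (a₂ ~ a₁)) ∨ (b₃ ∧ (a₂ ~ a₃))`. -/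
lemma conn_a2b : Conn ends x a₂ b ↔
    (Conn ends (withinRestr ends WB x) a₂ b ∨
      (Conn ends (withinRestr ends WB x) a₁ b ∧
        (Conn ends (withinRestr ends WB x) a₂ a₁ ∨
          (Conn ends (withinRestr ends WO x) a₁ a₃ ∧
            Conn ends (withinRestr ends WB x) a₂ a₃)))) ∨
      (Conn ends (withinRestr ends WB x) a₃ b ∧
        (Conn ends (withinRestr ends WB x) a₂ a₃ ∨
          (Conn ends (withinRestr ends WO x) a₁ a₃ ∧
            Conn ends (withinRestr ends WB x) a₂ a₁))) := by
  have hin := conn_inside ends (hsp' hsp) (cap' h) h.a1B h.a1O h.a3B h.a3O h.a2B h.bB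
  rw [conn_a1a3 h hsp] at hin
  constructor
  · intro hc
    rcases hin.1 hc with hc | ⟨hX | hY, ⟨h21, h3b⟩ | ⟨h23, h1b⟩⟩
    · exact Or.inl (Or.inl hc)
    · exact Or.inr ⟨h3b, Or.inr ⟨hX, h21⟩⟩
    · exact Or.inl (Or.inr ⟨h1b, Or.inr ⟨hX, h23⟩⟩)
    · exact Or.inr ⟨h3b, Or.inl (conn_trans h21 hY)⟩
    · exact Or.inl (Or.inr ⟨h1b, Or.inl (conn_trans h23 (conn_symm hY))⟩)
  · rintro ((hc | ⟨h1b, h21⟩) | ⟨h3b, h23⟩)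
    · exact conn_mono (withinRestr_le ends WB x) hc
    · exact conn_trans ((conn_a2a1 h hsp).2 h21) (conn_mono (withinRestr_le ends WB x) h1b)
    · exact conn_trans ((conn_a2a3 h hsp).2 h23) (conn_mono (withinRestr_le ends WB x) h3b)

end Coords

omit [Fintype E] in
/-- **The state of a copy of the support is the gluing of its side states.** -/
theorem st_eq_sepSt (h : Split ends o a₁ a₂ a₃ b WO WB F z) {x : Config E}
    (hx : x ≤ zF F z) :
    st ends o a₁ a₂ a₃ b x = glued (oSt ends o a₁ a₃ WO x) (bSt ends a₁ a₂ a₃ b WB x) := by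
  have hsp := split_of_le h hx
  have e1 := conn_a2a1 h hsp
  have e2 := conn_a1o h hsp
  have e3 := conn_a2o h hsp
  have e4 := conn_a1b h hsp
  have e5 := conn_a2b h hsp
  have e6 := conn_a1a3 h hsp
  have e7 := conn_a2a3 h hsp
  unfold st glued oSt bSt
  rw [decide_eq_decide.mpr e1, decide_eq_decide.mpr e2, decide_eq_decide.mpr e3,
    decide_eq_decide.mpr e4, decide_eq_decide.mpr e5, decide_eq_decide.mpr e6,
    decide_eq_decide.mpr e7]
  simp only [Bool.decide_or, Bool.decide_and]
  all_goals infer_instance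

end Support

end SepThree

end CovForm

end Summit.Ventures.PercRepro2
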